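import Summits.Ventures.LatticeQCDFlow.Scoring.WilsonFlowRK3Reflection
import HarnessLib

/-!
# Kick–drift molecular-dynamics words on `SU(n)^E × 𝔰𝔲(n)^E` — leapfrog, OMF2, the engine's OMF4, any coefficients: equivariance under gauge transformations, translations and the time reflection lifted to phase space, and invariance of the Hamiltonian and of `ΔH`

HONEST FRAMING: exact (Metropolis-corrected) sampling algorithms for lattice gauge theory;
figures of merit are autocorrelation/cost numbers at stated couplings and volumes; no
continuum-physics claim.

Venture `LatticeQCDFlow` (cell pub-lqcd), sub-topic `Scoring`; FANOUT row 16 (`su2-base`; arm E2 = HMC with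
the OMF4 integrator at `τ = 1` for the `SU(2)` Wilson action).  NEW WORK of the cell over
`Scoring/WilsonFlowRK3` / `WilsonFlowRK3Reflection` (the `𝔰𝔲(n)`-register calculus: `rkRegister a b ε X W =
aε·Z(W) + b·X`, `rkPush X W = e^X W`, `gaugeReg`, `transReg`, `reflReg` and their covariance lemmas) and the
Literature's invariances of the Wilson action (`wilsonAction_gaugeTransform`, `wilsonAction_torusConfigShift`,
`SpeciesTimeReflection.wilsonAction_negReflect_eq`).  Nothing is cited as a fact; no number.  Printed
counterparts, NAMED ONLY: Duane–Kennedy–Pendleton–Roweth 1987 (HMC), Omelyan–Mryglod–Folk 2003 (the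
11-stage scheme), Kennedy–Pendleton on gauge-covariant MD.

## Observation

The engine's HMC molecular dynamics (`latflow.core.hmc`: `_upd_P`: `P ← P − cε·(β/2N)·TA(U R)`, `_upd_U`:
`U ← e^{cεP} U`) is a WORD in the two primitives of the RK3 files: a kick is `rkRegister (cβ/2N) 1 ε P U`
(because `−TA(UR) = Z(U)`, Lüscher's generator) and a drift is `rkPush ((cε)·P) U`.  Hence the stage lemmas
proved for the Wilson-flow integrator give, by induction on the word, the equivariance of EVERY kick–drift
integrator under the three symmetries — with the momenta transforming as registers do: `Ad_{g(x)}`,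
translation, and under `Θ'` the transport `reflReg U` (a temporal momentum is carried to the far end of its
reversed link and negated, relative to the CURRENT links; drifts do not disturb this because `e^{cP_e}`
commutes with `P_e`, `reflReg_rkPush_smul`).

## What is here (every `d`, `L`, `n`, `ε`, all coefficients)

* §1 `MDPhase`, `MDOp` (`kick c` / `drift a`), `MDOp.apply`, `mdWord` (+ `mdWord_append`, kick fusion
  `MDOp.apply_kick_kick`), the engine's `leapfrogWord κ` and `omf4Word κ ρ θ ϑ λ`.
* §2 `gaugePhase g (U,P) = (U^g, Ad_g P)`; **`mdWord_gaugePhase`**: `Φ_w ∘ gaugePhase g = gaugePhase g ∘ Φ_w`.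
* §3 `transPhase a`; **`mdWord_transPhase`**.
* §4 (`d ≥ 1`) `reflPhase (U,P) = (Θ'U, reflReg U P)`; `reflReg_smul`, `reflReg_rkPush_smul`;
  **`mdWord_reflPhase`**: `Φ_w(Θ'U, reflReg U P) = (Θ'U', reflReg U' P')`.
* §5 `kinetic P = Σ_e Re tr(P_eᴴP_e)` (`= ½Σ(pᵃ)²`), `mdHamiltonian S (U,P) = S U + kinetic P`;
  `kinetic_neg / _gaugeReg / _transReg / _reflReg` (the three transports are isometries and re-enumerate the
  links: `negReflect_shift_zero_involutive`); `mdHamiltonian_flip / _gaugePhase / _transPhase / _reflPhase`;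
  **`energyChange_reflPhase`**, `energyChange_gaugePhase`: `ΔH_w` is invariant; and for row 16's Hamiltonian
  `β S_W + K` (`wilsonMDAction_invariances`): **`wilson_energyChange_reflPhase`** — the `ΔH` presented to the
  Metropolis test after ANY kick–drift trajectory is the same on `(U, P)` and on `(Θ'U, reflReg U P)`.

NOT here (the stochastic half of "the HMC kernel commutes with `Θ'`"): invariance of the Gaussian momentum
law under `P ↦ reflReg U P` (an isometric re-enumeration, but a measure statement), the Metropolis kernel
algebra (`SymmetricSamplerOddObservables` consumes exactly such a commuting kernel), reversibility /
volume preservation of the words (in the tree: `Exactness/SplittingWords`, `SU2LeapfrogHMC`), any number.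
-/

noncomputable section

open Matrix Literature.MathematicalPhysics.QuantumFieldTheory
open Literature.MathematicalPhysics.QuantumLattice (fundamentalRep continuous_fundamentalRep)

namespace Summit.Ventures.LatticeQCDFlow.Scoring

variable {d L n : ℕ}

/-! ## §1 Phase space, kicks, drifts, words -/

section Words

/-- HMC phase space over the torus: an `SU(n)` link field and an `𝔰𝔲(n)`-valued momentum field. -/
abbrev MDPhase (d L n : ℕ) : Type :=
  GaugeConfig d L (Matrix.specialUnitaryGroup (Fin n) ℂ) × (Edge d L → suAlgebra n)

/-- One molecular-dynamics instruction: a momentum KICK of weight `c` (`P ← P + cε·Z(U)`, `Z = −P(Ω)` the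
Wilson generator — the engine's `P -= coef·eps·TA(U R)` with `c = coef`) or a link DRIFT of weight `a`
(`U ← e^{aε P} U`, the engine's `U = expm(a·eps·P) U`). -/
inductive MDOp : Type
  | kick (c : ℝ) : MDOp
  | drift (a : ℝ) : MDOp

/-- The action of one instruction at step size `ε`: a kick is the register update `rkRegister c 1 ε P U`
(field unchanged), a drift is the push `rkPush ((aε)·P) U` (momentum unchanged). -/
def MDOp.apply (ε : ℝ) : MDOp → MDPhase d L n → MDPhase d L n
  | MDOp.kick c, z => (z.1, rkRegister c 1 ε z.2 z.1)
  | MDOp.drift a, z => (rkPush ((a * ε) • z.2) z.1, z.2)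

/-- A kick–drift WORD applied left to right (leapfrog `[kick ½κ, drift 1, kick ½κ]`, the OMF2 / OMF4 words
of the engine with their constants, or any other splitting; a trajectory is the word repeated). -/
def mdWord (ε : ℝ) : List MDOp → MDPhase d L n → MDPhase d L n
  | [] => id
  | op :: w => mdWord ε w ∘ op.apply ε

/-- A word acts by its first letter, then the rest. -/
@[simp] theorem mdWord_cons (ε : ℝ) (op : MDOp) (w : List MDOp) (z : MDPhase d L n) :
    mdWord ε (op :: w) z = mdWord ε w (op.apply ε z) := rfl

/-- Concatenated words compose (a trajectory of `k` steps is the step word repeated). -/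
theorem mdWord_append (ε : ℝ) (w₁ w₂ : List MDOp) (z : MDPhase d L n) :
    mdWord ε (w₁ ++ w₂) z = mdWord ε w₂ (mdWord ε w₁ z) := by
  induction w₁ generalizing z with
  | nil => rfl
  | cons op w ih => exact ih _

/-- **Kick fusion**: two consecutive kicks see the same link field, so they add —
`kick b ∘ kick a = kick (a + b)`; this is why the engine merges the last kick of one MD step with the first
kick of the next (`2·ϑ·ε`, `2·λ·ε` in `hmc.py`) without changing the trajectory. -/
theorem MDOp.apply_kick_kick (ε a b : ℝ) (z : MDPhase d L n) :
    (MDOp.kick b).apply ε ((MDOp.kick a).apply ε z) = (MDOp.kick (a + b)).apply (d := d) (L := L) (n := n) ε z := by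
  obtain ⟨U, P⟩ := z
  simp only [MDOp.apply, Prod.mk.injEq, true_and]
  funext e
  simp only [rkRegister, one_smul, add_mul, add_smul]
  abel

/-- The leapfrog step of the engine (`hmc.py`, `integrator = "leapfrog"`), force scale `κ = β/(2N)`:
`P += ½εκZ; U ← e^{εP}U; P += ½εκZ`. -/
def leapfrogWord (κ : ℝ) : List MDOp := [MDOp.kick (κ / 2), MDOp.drift 1, MDOp.kick (κ / 2)]

/-- The 11-stage fourth-order Omelyan–Mryglod–Folk step of the engine (`hmc.py`, `integrator = "omf4"`,
position-first velocity form with constants `ρ, θ, ϑ, λ`; force scale `κ = β/(2N)`):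
`K(ϑ) D(ρ) K(λ) D(θ) K(½−λ−ϑ) D(1−2(θ+ρ)) K(½−λ−ϑ) D(θ) K(λ) D(ρ) K(ϑ)`. -/
def omf4Word (κ ρ θ ϑ lam : ℝ) : List MDOp :=
  [MDOp.kick (ϑ * κ), MDOp.drift ρ, MDOp.kick (lam * κ), MDOp.drift θ, MDOp.kick ((1 / 2 - (lam + ϑ)) * κ),
    MDOp.drift (1 - 2 * (θ + ρ)), MDOp.kick ((1 / 2 - (lam + ϑ)) * κ), MDOp.drift θ, MDOp.kick (lam * κ),
    MDOp.drift ρ, MDOp.kick (ϑ * κ)]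

end Words

/-! ## §2 Gauge equivariance of every word -/

section Gauge

variable (g : Site d L → Matrix.specialUnitaryGroup (Fin n) ℂ)

/-- The gauge transformation lifted to phase space: links by `U ↦ U^g`, momenta by `Ad_{g(x)}`. -/
def gaugePhase (z : MDPhase d L n) : MDPhase d L n := (gaugeTransform g z.1, gaugeReg g z.2)

/-- `Ad_g` is linear on registers. -/
theorem gaugeReg_smul (c : ℝ) (X : Edge d L → suAlgebra n) : gaugeReg g (c • X) = c • gaugeReg g X := by
  funext e
  simp only [gaugeReg, Pi.smul_apply, suConj_smul]

/-- Every instruction commutes with the lifted gauge transformation. -/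
theorem MDOp.apply_gaugePhase (ε : ℝ) (op : MDOp) (z : MDPhase d L n) :
    op.apply ε (gaugePhase g z) = gaugePhase g (op.apply ε z) := by
  cases op with
  | kick c => simp only [MDOp.apply, gaugePhase, rkRegister_gaugeTransform]
  | drift a => simp only [MDOp.apply, gaugePhase, ← gaugeReg_smul, rkPush_gaugeTransform]

/-- **Every kick–drift word is gauge equivariant**: `Φ_w(U^g, Ad_g P) = (Φ_w(U, P))^g`. -/
theorem mdWord_gaugePhase (ε : ℝ) (w : List MDOp) (z : MDPhase d L n) :
    mdWord ε w (gaugePhase g z) = gaugePhase g (mdWord ε w z) := by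
  induction w generalizing z with
  | nil => rfl
  | cons op w ih => rw [mdWord_cons, mdWord_cons, MDOp.apply_gaugePhase, ih]

end Gauge

/-! ## §3 Translation equivariance of every word -/

section Translation

variable (a : Site d L)

/-- The lattice translation lifted to phase space. -/
def transPhase (z : MDPhase d L n) : MDPhase d L n := (z.1.siteTranslate a, transReg a z.2)

omit a in
/-- Translation is linear on registers. -/
theorem transReg_smul (a : Site d L) (c : ℝ) (X : Edge d L → suAlgebra n) :
    transReg a (c • X) = c • transReg a X := rfl

/-- Every instruction commutes with the lifted translation. -/
theorem MDOp.apply_transPhase (ε : ℝ) (op : MDOp) (z : MDPhase d L n) :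
    op.apply ε (transPhase a z) = transPhase a (op.apply ε z) := by
  cases op with
  | kick c => simp only [MDOp.apply, transPhase, rkRegister_siteTranslate]
  | drift a' => simp only [MDOp.apply, transPhase, ← transReg_smul, rkPush_siteTranslate]

/-- **Every kick–drift word is translation equivariant.** -/
theorem mdWord_transPhase (ε : ℝ) (w : List MDOp) (z : MDPhase d L n) :
    mdWord ε w (transPhase a z) = transPhase a (mdWord ε w z) := by
  induction w generalizing z with
  | nil => rfl
  | cons op w ih => rw [mdWord_cons, mdWord_cons, MDOp.apply_transPhase, ih]

end Translation

/-! ## §4 Equivariance under the time reflection lifted to phase space -/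

section Reflection

variable [NeZero d]

/-- The time reflection lifted to phase space: links by `Θ'`, momenta by the transport `reflReg U` relative to
the CURRENT link field (a temporal momentum is carried to the far end of its reversed link and negated). -/
def reflPhase (z : MDPhase d L n) : MDPhase d L n := (z.1.negReflect, reflReg z.1 z.2)

/-- The transport is linear on registers. -/
theorem reflReg_smul (W : GaugeConfig d L (Matrix.specialUnitaryGroup (Fin n) ℂ)) (c : ℝ)
    (X : Edge d L → suAlgebra n) : reflReg W (c • X) = c • reflReg W X := by
  funext e
  obtain ⟨x, μ⟩ := e
  by_cases hμ : μ = 0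
  · subst hμ
    simp only [reflReg_apply_zero, Pi.smul_apply, suConj_smul, smul_neg]
  · simp only [reflReg_apply_of_ne _ _ _ hμ, Pi.smul_apply]

/-- **Re-basing after a drift**: transporting relative to the drifted field `e^{cX} W` is the same as
relative to `W` (the drift factor `e^{cX(y,0)}` commutes with `X(y,0)`). -/
theorem reflReg_rkPush_smul (c : ℝ) (X : Edge d L → suAlgebra n)
    (W : GaugeConfig d L (Matrix.specialUnitaryGroup (Fin n) ℂ)) : reflReg (rkPush (c • X) W) X = reflReg W X := by
  funext e
  obtain ⟨x, μ⟩ := e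
  by_cases hμ : μ = 0
  · subst hμ
    rw [reflReg_apply_zero, reflReg_apply_zero]
    congr 1
    apply Subtype.ext
    rw [coe_suConj, coe_suConj, WilsonFlow.coe_inv_SU, WilsonFlow.coe_inv_SU, Matrix.conjTranspose_conjTranspose,
      Matrix.conjTranspose_conjTranspose, rkPush, WilsonFlow.coe_mul_SU, coe_expSU, Matrix.conjTranspose_mul,
      Pi.smul_apply, Submodule.coe_smul]
    set A : Matrix (Fin n) (Fin n) ℂ :=
      ((W ((x.shift 0).negReflect, 0) : Matrix.specialUnitaryGroup (Fin n) ℂ) : Matrix (Fin n) (Fin n) ℂ)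
    set Y : Matrix (Fin n) (Fin n) ℂ := ((X ((x.shift 0).negReflect, 0) : suAlgebra n) : Matrix (Fin n) (Fin n) ℂ)
    have hc : Commute (NormedSpace.exp (c • Y)) Y := ((Commute.refl Y).smul_left c).exp_left
    have h1 : (NormedSpace.exp (c • Y))ᴴ * NormedSpace.exp (c • Y) = 1 :=
      WilsonFlow.conjTranspose_mul_self_SU (expSU (c • X ((x.shift 0).negReflect, 0)))
    calc Aᴴ * (NormedSpace.exp (c • Y))ᴴ * Y * (NormedSpace.exp (c • Y) * A)
        = Aᴴ * ((NormedSpace.exp (c • Y))ᴴ * (Y * NormedSpace.exp (c • Y))) * A := by simp only [Matrix.mul_assoc]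
      _ = Aᴴ * ((NormedSpace.exp (c • Y))ᴴ * (NormedSpace.exp (c • Y) * Y)) * A := by rw [hc.eq]
      _ = Aᴴ * (((NormedSpace.exp (c • Y))ᴴ * NormedSpace.exp (c • Y)) * Y) * A := by simp only [Matrix.mul_assoc]
      _ = Aᴴ * Y * A := by rw [h1, Matrix.one_mul]
  · rw [reflReg_apply_of_ne _ _ _ hμ, reflReg_apply_of_ne _ _ _ hμ]

/-- Every instruction commutes with the lifted reflection. -/
theorem MDOp.apply_reflPhase (ε : ℝ) (op : MDOp) (z : MDPhase d L n) :
    op.apply ε (reflPhase z) = reflPhase (op.apply ε z) := by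
  cases op with
  | kick c => simp only [MDOp.apply, reflPhase, rkRegister_negReflect]
  | drift a =>
      simp only [MDOp.apply, reflPhase]
      rw [← reflReg_smul, rkPush_negReflect, reflReg_rkPush_smul]

/-- **Every kick–drift word commutes with the time reflection lifted to phase space**:
`Φ_w(Θ'U, reflReg U P) = (Θ'U', reflReg U' P')` where `(U', P') = Φ_w(U, P)` — leapfrog, OMF2, OMF4,
any coefficients, any number of MD steps (`mdWord_append`). -/
theorem mdWord_reflPhase (ε : ℝ) (w : List MDOp) (z : MDPhase d L n) :
    mdWord ε w (reflPhase z) = reflPhase (mdWord ε w z) := by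
  induction w generalizing z with
  | nil => rfl
  | cons op w ih => rw [mdWord_cons, mdWord_cons, MDOp.apply_reflPhase, ih]

end Reflection

/-! ## §5 The Hamiltonian is invariant under the three lifted maps and the momentum flip -/

section Hamiltonian

/-- The far-end map of temporal links, `x ↦ θ'(x + e₀)`, is an involution of the sites. -/
theorem negReflect_shift_zero_involutive [NeZero d] :
    Function.Involutive fun x : Site d L => (x.shift 0).negReflect := by
  intro x
  show (((x + Pi.single 0 1).negReflect + Pi.single 0 1)).negReflect = x
  rw [negReflect_add_single_zero, WilsonSiteRP.negReflect_negReflect, add_sub_cancel_right]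

variable [NeZero L]

/-- Kinetic energy of a momentum field, `K(P) = Σ_e Re tr(P_eᴴ P_e) = Σ_e ‖P_e‖_F²` (`= ½ Σ_{e,a} (p_e^a)²` in
the basis `tr TᵃTᵇ = −½δ`, the engine's `0.5*sum(p**2)`). -/
def kinetic (P : Edge d L → suAlgebra n) : ℝ :=
  ∑ e, (((P e : suAlgebra n) : Matrix (Fin n) (Fin n) ℂ)ᴴ * ((P e : suAlgebra n) : Matrix (Fin n) (Fin n) ℂ)).trace.re

/-- The MD Hamiltonian `H(U, P) = S(U) + K(P)` for an action `S` (for the engine, `S = β·S_W`). -/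
def mdHamiltonian (S : GaugeConfig d L (Matrix.specialUnitaryGroup (Fin n) ℂ) → ℝ) (z : MDPhase d L n) : ℝ :=
  S z.1 + kinetic z.2

/-- `K ≥ 0`. -/
theorem kinetic_nonneg (P : Edge d L → suAlgebra n) : 0 ≤ kinetic P := by
  unfold kinetic
  exact Finset.sum_nonneg fun e _ => WilsonFlow.re_trace_conjTranspose_mul_self_nonneg _

/-- `K(−P) = K(P)` (momentum flip). -/
theorem kinetic_neg (P : Edge d L → suAlgebra n) : kinetic (-P) = kinetic P := by
  unfold kinetic
  simp only [Pi.neg_apply, Submodule.coe_neg, Matrix.conjTranspose_neg, Matrix.neg_mul, Matrix.mul_neg, neg_neg]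

/-- `‖g X gᴴ‖_F² = ‖X‖_F²` for `g ∈ SU(n)`. -/
theorem trace_conjTranspose_mul_suConj (g : Matrix.specialUnitaryGroup (Fin n) ℂ) (X : suAlgebra n) :
    (((suConj g X : suAlgebra n) : Matrix (Fin n) (Fin n) ℂ)ᴴ * ((suConj g X : suAlgebra n) : Matrix (Fin n) (Fin n) ℂ)).trace =
      (((X : Matrix (Fin n) (Fin n) ℂ))ᴴ * (X : Matrix (Fin n) (Fin n) ℂ)).trace := by
  rw [coe_suConj]
  set G : Matrix (Fin n) (Fin n) ℂ := (g : Matrix (Fin n) (Fin n) ℂ)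
  set Y : Matrix (Fin n) (Fin n) ℂ := (X : Matrix (Fin n) (Fin n) ℂ)
  have hg : Gᴴ * G = 1 := WilsonFlow.conjTranspose_mul_self_SU g
  calc ((G * Y * Gᴴ)ᴴ * (G * Y * Gᴴ)).trace = ((G * Yᴴ) * (Gᴴ * G) * (Y * Gᴴ)).trace := by
        simp only [Matrix.conjTranspose_mul, Matrix.conjTranspose_conjTranspose, Matrix.mul_assoc]
    _ = ((G * Yᴴ) * (Y * Gᴴ)).trace := by rw [hg, Matrix.mul_one]
    _ = ((Y * Gᴴ) * (G * Yᴴ)).trace := Matrix.trace_mul_comm _ _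
    _ = (Y * (Gᴴ * G) * Yᴴ).trace := by simp only [Matrix.mul_assoc]
    _ = (Y * Yᴴ).trace := by rw [hg, Matrix.mul_one]
    _ = (Yᴴ * Y).trace := Matrix.trace_mul_comm _ _

/-- `K(Ad_g P) = K(P)`. -/
theorem kinetic_gaugeReg (g : Site d L → Matrix.specialUnitaryGroup (Fin n) ℂ) (P : Edge d L → suAlgebra n) :
    kinetic (gaugeReg g P) = kinetic P := by
  unfold kinetic
  exact Finset.sum_congr rfl fun e _ => by simp only [gaugeReg, trace_conjTranspose_mul_suConj]

/-- `K(τ_a P) = K(P)`. -/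
theorem kinetic_transReg (a : Site d L) (P : Edge d L → suAlgebra n) : kinetic (transReg a P) = kinetic P :=
  Fintype.sum_equiv ((Equiv.addRight a).prodCongr (Equiv.refl (Fin d))) _ _ fun _ => rfl

/-- **`K(reflReg U P) = K(P)`**: the transport permutes the spatial momenta, and carries each temporal momentum
by an isometry `X ↦ −A⁻¹XA` to a link that is again enumerated once (`negReflect_shift_zero_involutive`). -/
theorem kinetic_reflReg [NeZero d] (W : GaugeConfig d L (Matrix.specialUnitaryGroup (Fin n) ℂ))
    (P : Edge d L → suAlgebra n) : kinetic (reflReg W P) = kinetic P := by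
  unfold kinetic
  rw [Fintype.sum_prod_type_right, Fintype.sum_prod_type_right]
  refine Finset.sum_congr rfl fun μ _ => ?_
  by_cases hμ : μ = 0
  · subst hμ
    simp only [reflReg_apply_zero, Submodule.coe_neg, Matrix.conjTranspose_neg, Matrix.neg_mul, Matrix.mul_neg,
      neg_neg, trace_conjTranspose_mul_suConj]
    exact Fintype.sum_equiv (Function.Involutive.toPerm _ negReflect_shift_zero_involutive) _ _ fun x => rfl
  · simp only [reflReg_apply_of_ne _ _ _ hμ]
    exact Fintype.sum_equiv (Function.Involutive.toPerm _ WilsonSiteRP.negReflect_negReflect) _ _ fun x => rfl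

/-- **`H` is invariant under the momentum flip.** -/
theorem mdHamiltonian_flip (S : GaugeConfig d L (Matrix.specialUnitaryGroup (Fin n) ℂ) → ℝ) (z : MDPhase d L n) :
    mdHamiltonian S (z.1, -z.2) = mdHamiltonian S z := by
  simp only [mdHamiltonian, kinetic_neg]

/-- **`H` is invariant under the lifted gauge transformation** for a gauge-invariant action. -/
theorem mdHamiltonian_gaugePhase {S : GaugeConfig d L (Matrix.specialUnitaryGroup (Fin n) ℂ) → ℝ}
    (hS : IsGaugeInvariant S) (g : Site d L → Matrix.specialUnitaryGroup (Fin n) ℂ) (z : MDPhase d L n) :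
    mdHamiltonian S (gaugePhase g z) = mdHamiltonian S z := by
  simp only [mdHamiltonian, gaugePhase, hS g, kinetic_gaugeReg]

/-- **`H` is invariant under the lifted translation** for a translation-invariant action. -/
theorem mdHamiltonian_transPhase {S : GaugeConfig d L (Matrix.specialUnitaryGroup (Fin n) ℂ) → ℝ}
    (hS : ∀ (v : Site d L) (U : GaugeConfig d L (Matrix.specialUnitaryGroup (Fin n) ℂ)), S (U.siteTranslate v) = S U)
    (a : Site d L) (z : MDPhase d L n) : mdHamiltonian S (transPhase a z) = mdHamiltonian S z := by
  simp only [mdHamiltonian, transPhase, hS, kinetic_transReg]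

/-- **`H` is invariant under the lifted time reflection** for a `Θ'`-invariant action. -/
theorem mdHamiltonian_reflPhase [NeZero d] {S : GaugeConfig d L (Matrix.specialUnitaryGroup (Fin n) ℂ) → ℝ}
    (hS : ∀ U : GaugeConfig d L (Matrix.specialUnitaryGroup (Fin n) ℂ), S U.negReflect = S U) (z : MDPhase d L n) :
    mdHamiltonian S (reflPhase z) = mdHamiltonian S z := by
  simp only [mdHamiltonian, reflPhase, hS, kinetic_reflReg]

/-- **The energy change along any kick–drift word is invariant under the lifted reflection**:
`ΔH_w(Θ'U, reflReg U P) = ΔH_w(U, P)` — so the Metropolis test at the end of an HMC trajectory sees the same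
`ΔH` on a configuration and on its reflection (with transported momenta). -/
theorem energyChange_reflPhase [NeZero d] {S : GaugeConfig d L (Matrix.specialUnitaryGroup (Fin n) ℂ) → ℝ}
    (hS : ∀ U : GaugeConfig d L (Matrix.specialUnitaryGroup (Fin n) ℂ), S U.negReflect = S U) (ε : ℝ)
    (w : List MDOp) (z : MDPhase d L n) :
    mdHamiltonian S (mdWord ε w (reflPhase z)) - mdHamiltonian S (reflPhase z) =
      mdHamiltonian S (mdWord ε w z) - mdHamiltonian S z := by
  rw [mdWord_reflPhase, mdHamiltonian_reflPhase hS, mdHamiltonian_reflPhase hS]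

/-- The same under the lifted gauge transformation. -/
theorem energyChange_gaugePhase {S : GaugeConfig d L (Matrix.specialUnitaryGroup (Fin n) ℂ) → ℝ}
    (hS : IsGaugeInvariant S) (g : Site d L → Matrix.specialUnitaryGroup (Fin n) ℂ) (ε : ℝ) (w : List MDOp)
    (z : MDPhase d L n) : mdHamiltonian S (mdWord ε w (gaugePhase g z)) - mdHamiltonian S (gaugePhase g z) =
      mdHamiltonian S (mdWord ε w z) - mdHamiltonian S z := by
  rw [mdWord_gaugePhase, mdHamiltonian_gaugePhase hS, mdHamiltonian_gaugePhase hS]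

/-! ### The Wilson action of row 16 (`SU(n)` fundamental, coupling `β`) -/

/-- The engine's action `S = β·S_W` is gauge invariant, translation invariant and `Θ'`-invariant
(Literature: `wilsonAction_gaugeTransform`, `wilsonAction_siteTranslate` via `torusConfigShift`,
`wilsonAction_negReflect_eq`). -/
theorem wilsonMDAction_invariances [NeZero d] (β : ℝ) :
    IsGaugeInvariant (fun U : GaugeConfig d L (Matrix.specialUnitaryGroup (Fin n) ℂ) =>
        β * wilsonAction (fundamentalRep (Fin n)) U) ∧
      (∀ (v : Site d L) (U : GaugeConfig d L (Matrix.specialUnitaryGroup (Fin n) ℂ)),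
        β * wilsonAction (fundamentalRep (Fin n)) (U.siteTranslate v) = β * wilsonAction (fundamentalRep (Fin n)) U) ∧
      ∀ U : GaugeConfig d L (Matrix.specialUnitaryGroup (Fin n) ℂ),
        β * wilsonAction (fundamentalRep (Fin n)) U.negReflect = β * wilsonAction (fundamentalRep (Fin n)) U := by
  refine ⟨fun g U => by simp only [wilsonAction_gaugeTransform], fun v U => ?_, fun U => ?_⟩
  · have h := wilsonAction_torusConfigShift (fundamentalRep (Fin n)) (-v) U
    rw [torusConfigShift_eq_siteTranslate, neg_neg] at h
    rw [h]
  · rw [wilsonAction_negReflect_eq (fundamentalRep (Fin n)) (continuous_fundamentalRep (Fin n))]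

/-- **Row 16's E2 arm**: for the Wilson `SU(n)` Hamiltonian `H = β S_W(U) + K(P)` and ANY kick–drift word
(the engine's OMF4 trajectory of `n_md` steps at `τ = 1` included), the energy change presented to the
Metropolis test is invariant under the lifted time reflection and the lifted gauge transformations. -/
theorem wilson_energyChange_reflPhase [NeZero d] (β ε : ℝ) (w : List MDOp) (z : MDPhase d L n) :
    mdHamiltonian (fun U => β * wilsonAction (fundamentalRep (Fin n)) U) (mdWord ε w (reflPhase z)) -
        mdHamiltonian (fun U => β * wilsonAction (fundamentalRep (Fin n)) U) (reflPhase z) =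
      mdHamiltonian (fun U => β * wilsonAction (fundamentalRep (Fin n)) U) (mdWord ε w z) -
        mdHamiltonian (fun U => β * wilsonAction (fundamentalRep (Fin n)) U) z :=
  energyChange_reflPhase (wilsonMDAction_invariances β).2.2 ε w z

end Hamiltonian


end Summit.Ventures.LatticeQCDFlow.Scoring

end
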